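import Mathlib.Tactic.LinearCombination
import Summits.MatrixMultiplication.OmegaCensus.DihedralLawModOneShapeBLemmas
import HarnessLib

/-!
# The law shape `(c, c+1 | 2, 2 | 1, 1)` at `|A| ≡ 1 (mod 3)`: additive core

ω-census, family (b3).  Framing: lottery ticket; floor = certified bounds/negative ranges.

Additive-combinatorial core of the classification of the law-attaining TPP triples of shape
`(c, c+1 | 2, 2 | 1, 1)` in a dihedral-like group over a finite abelian group `A` with `|A| = 6c + 4`
(`VertexCountingModOneShape.lean`, shape (β-ii); wrapper in `DihedralLawModOneShapeB.lean`).

After normalisation (`T₀ = {0, t}`, `T₁ = a₀ + {0, t'}`, `U₀ = {0}`, `U₁ = {w}`, `d = a₀ − w`, `Y = S₁`,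
`Q = S₀ + a₀ − 2d`) the vertex constraints of such a triple say:

* (T2, vertex `111`) `A = (Q + 2d + {0,t'}) ⊔ (Y + {0,t}) ⊔ (Y + d + {0,t'})`;
* (T1, vertex `101`) `A = (Q + 2d + {0,−t}) ⊔ (Y + c₀ + {0,−t'}) ⊔ (Y + d + {0,−t})`;
* (Per, vertex `110`) `Y + {0,t'}` is `c₀`-periodic;
* (★, vertex `000`) `Q + {0,t} ⊆ Y + {0,t'}`;

together with `|Y| = |Q| + 1` and the injectivity of the boxes (`Y`, `Q` are `t`- and `t'`-free).

**Theorem (`two_cosets_of_shapeB`).** These force `A` to be the union of two cosets of a cyclic subgroup.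

*Proof.* Character sums: eliminating `Q̂` between (T1) and (T2) (using (Per)) gives
`Ŷ(ψ)·(ψ t + ψ(−t) − ψ t' − ψ(−t')) = 0`, i.e. `Ŷ` and then `Q̂` vanish at every `ψ` with
`ψ(t − t') ≠ 1 ≠ ψ(t + t')`; by (★) the two points `E = (Y ⊔ (Y+t')) ∖ (Q ⊔ (Q+t)) = {y₀, y₁ + t'}`
(`y₀, y₁ ∈ Y`, a domino count) then satisfy `(ψ y₀ + ψ(y₁+t'))(1 − ψ(t−t'))(1 − ψ(t+t')) = 0` for all `ψ`,
and Fourier inversion at the points `y₀`, `y₁ + t'` contradicts `Y ∩ (Y + t) = ∅` unless `t' = ±t`.  For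
`t' = ±t`, (T2) and (★) exhibit `A = P ⊔ (P + e) ⊔ C` with `P = Y ⊔ (Y+t)`, `|P| = |C| + 2`, `C ⊆ P + 2e`
(`e = d` resp. `d − t`), and `two_cosets_of_near_tiling_two` concludes.
-/


namespace Summit.MatrixMultiplication.OmegaCensus

open Finset

section ShapeB

variable {A : Type*} [AddCommGroup A] [Fintype A] [DecidableEq A]

/-- **The character identity of shape (β-ii).** Under (T1), (T2), (Per), (★) (see the module docstring), with
`E = (Y ⊔ (Y+t')) ∖ (Q ⊔ (Q+t)) = {y₀, y₁ + t'}`: for every character `ψ`,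
`(ψ y₀ + ψ(y₁ + t'))·(1 − ψ(t − t'))·(1 − ψ(t + t')) = 0`. [folklore] -/
theorem shapeB_char_identity {Q Y : Finset A} {t t' d c₀ y₀ y₁ : A}
    (hYt : Disjoint Y (Y.image (· + t))) (hYt' : Disjoint Y (Y.image (· + t')))
    (hQt : Disjoint Q (Q.image (· + t))) (hQt' : Disjoint Q (Q.image (· + t')))
    (hA : Fintype.card A = 2 * Q.card + 4 * Y.card)
    (h12 : Disjoint (Q.image (· + (d + d)) ∪ Q.image (· + (d + d + t'))) (Y ∪ Y.image (· + t)))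
    (h13 : Disjoint (Q.image (· + (d + d)) ∪ Q.image (· + (d + d + t')))
      (Y.image (· + d) ∪ Y.image (· + (d + t'))))
    (h23 : Disjoint (Y ∪ Y.image (· + t)) (Y.image (· + d) ∪ Y.image (· + (d + t'))))
    (k12 : Disjoint (Q.image (· + (d + d)) ∪ Q.image (· + (d + d - t)))
      (Y.image (· + c₀) ∪ Y.image (· + (c₀ - t'))))
    (k13 : Disjoint (Q.image (· + (d + d)) ∪ Q.image (· + (d + d - t)))
      (Y.image (· + d) ∪ Y.image (· + (d - t))))
    (k23 : Disjoint (Y.image (· + c₀) ∪ Y.image (· + (c₀ - t'))) (Y.image (· + d) ∪ Y.image (· + (d - t))))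
    (hper : (Y ∪ Y.image (· + t')).image (· + c₀) = Y ∪ Y.image (· + t'))
    (hsub : Q ∪ Q.image (· + t) ⊆ Y ∪ Y.image (· + t'))
    (hE : (Y ∪ Y.image (· + t')) \ (Q ∪ Q.image (· + t)) = {y₀, y₁ + t'}) (hy₀ : y₀ ∈ Y) (hy₁ : y₁ ∈ Y)
    (ψ : AddChar A ℂ) :
    (ψ y₀ + ψ (y₁ + t')) * ((1 - ψ (t - t')) * (1 - ψ (t + t'))) = 0 := by
  by_cases hψ : ψ = 0
  · subst hψ; simp
  -- disjointness inside the pieces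
  have dB₁ : Disjoint (Q.image (· + (d + d))) (Q.image (· + (d + d + t'))) := disjoint_shift hQt' (d + d)
  have dB₃ : Disjoint (Y.image (· + d)) (Y.image (· + (d + t'))) := disjoint_shift hYt' d
  have dC₁ : Disjoint (Q.image (· + (d + d))) (Q.image (· + (d + d - t))) := by
    have h := disjoint_shift hQt (d + d - t); rw [sub_add_cancel] at h; exact h.symm
  have dC₂ : Disjoint (Y.image (· + c₀)) (Y.image (· + (c₀ - t'))) := by
    have h := disjoint_shift hYt' (c₀ - t'); rw [sub_add_cancel] at h; exact h.symm
  have dC₃ : Disjoint (Y.image (· + d)) (Y.image (· + (d - t))) := by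
    have h := disjoint_shift hYt (d - t); rw [sub_add_cancel] at h; exact h.symm
  -- (T2), (T1) as character identities
  have E2 := charsum_tiling' ψ hψ h12 h13 h23
    (by rw [card_two_translates dB₁, card_pair_union hYt, card_two_translates dB₃]; omega)
  have E1 := charsum_tiling' ψ hψ k12 k13 k23
    (by rw [card_two_translates dC₁, card_two_translates dC₂, card_two_translates dC₃]; omega)
  rw [charsum_two_translates ψ dB₁, charsum_pair_union ψ hYt, charsum_two_translates ψ dB₃] at E2
  rw [charsum_two_translates ψ dC₁, charsum_two_translates ψ dC₂, charsum_two_translates ψ dC₃] at E1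
  -- (Per)
  have P0 : (∑ x ∈ (Y ∪ Y.image (· + t')).image (· + c₀), ψ x) = ∑ x ∈ Y ∪ Y.image (· + t'), ψ x := by
    rw [hper]
  rw [charsum_image_add', charsum_pair_union ψ hYt'] at P0
  -- (★)
  have S0 : (∑ x ∈ (Y ∪ Y.image (· + t')) \ (Q ∪ Q.image (· + t)), ψ x) + ∑ x ∈ Q ∪ Q.image (· + t), ψ x =
      ∑ x ∈ Y ∪ Y.image (· + t'), ψ x := sum_sdiff hsub
  have hne : y₀ ≠ y₁ + t' := by
    intro h
    have : y₀ ∈ Y.image (· + t') := mem_image.2 ⟨y₁, hy₁, h.symm⟩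
    exact disjoint_left.1 hYt' hy₀ this
  rw [hE, sum_pair hne, charsum_pair_union ψ hQt, charsum_pair_union ψ hYt'] at S0
  -- abbreviations
  set q := ∑ x ∈ Q, ψ x with hq
  set y := ∑ x ∈ Y, ψ x with hy
  have haa : ψ t * ψ (-t) = 1 := addChar_mul_neg ψ t
  have hbb : ψ t' * ψ (-t') = 1 := addChar_mul_neg ψ t'
  have hδ : ψ d ≠ 0 := addChar_ne_zero ψ d
  have edd : ψ (d + d) = ψ d * ψ d := AddChar.map_add_eq_mul ψ d d
  have eddt' : ψ (d + d + t') = ψ d * ψ d * ψ t' := by rw [AddChar.map_add_eq_mul, edd]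
  have edt' : ψ (d + t') = ψ d * ψ t' := AddChar.map_add_eq_mul ψ d t'
  have eddt : ψ (d + d - t) = ψ d * ψ d * ψ (-t) := by rw [sub_eq_add_neg, AddChar.map_add_eq_mul, edd]
  have ect' : ψ (c₀ - t') = ψ c₀ * ψ (-t') := by rw [sub_eq_add_neg, AddChar.map_add_eq_mul]
  have edt : ψ (d - t) = ψ d * ψ (-t) := by rw [sub_eq_add_neg, AddChar.map_add_eq_mul]
  have eu : ψ (t - t') = ψ t * ψ (-t') := by rw [sub_eq_add_neg, AddChar.map_add_eq_mul]
  have ev : ψ (t + t') = ψ t * ψ t' := AddChar.map_add_eq_mul ψ t t'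
  have ey₁ : ψ (y₁ + t') = ψ y₁ * ψ t' := AddChar.map_add_eq_mul ψ y₁ t'
  rw [edd, eddt', edt'] at E2
  rw [edd, eddt, ect', edt] at E1
  -- Step 1: `y (a + a' - b - b') = 0`
  have Ha : y * (ψ t + ψ (-t) - ψ t' - ψ (-t')) = 0 := by
    linear_combination (1 + ψ (-t)) * E2 - (1 + ψ t') * E1 + (1 + ψ (-t')) * P0 - y * haa + y * hbb
  -- Step 2: `y Φ = 0`, `Φ = (1 - ψ u)(1 - ψ v)`
  have HyΦ : y * ((1 - ψ t * ψ (-t')) * (1 - ψ t * ψ t')) = 0 := by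
    linear_combination ψ t * Ha - y * haa + y * (ψ t) ^ 2 * hbb
  -- Step 3: `q Φ = 0`
  have H1 : q * (ψ d) ^ 2 * (1 + ψ t') * ((1 - ψ t * ψ (-t')) * (1 - ψ t * ψ t')) = 0 := by
    linear_combination ((1 - ψ t * ψ (-t')) * (1 - ψ t * ψ t')) * E2 - ((1 + ψ t) + ψ d * (1 + ψ t')) * HyΦ
  have H2 : q * (ψ d) ^ 2 * (1 + ψ (-t)) * ((1 - ψ t * ψ (-t')) * (1 - ψ t * ψ t')) = 0 := by
    linear_combination ((1 - ψ t * ψ (-t')) * (1 - ψ t * ψ t')) * E1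
      - (ψ c₀ * (1 + ψ (-t')) + ψ d * (1 + ψ (-t))) * HyΦ
  have hδ2 : (ψ d) ^ 2 ≠ 0 := pow_ne_zero 2 hδ
  have H1' : q * (1 + ψ t') * ((1 - ψ t * ψ (-t')) * (1 - ψ t * ψ t')) = 0 := by
    have h : (ψ d) ^ 2 * (q * (1 + ψ t') * ((1 - ψ t * ψ (-t')) * (1 - ψ t * ψ t'))) = 0 := by
      linear_combination H1
    exact (mul_eq_zero.1 h).resolve_left hδ2
  have H2' : q * (1 + ψ (-t)) * ((1 - ψ t * ψ (-t')) * (1 - ψ t * ψ t')) = 0 := by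
    have h : (ψ d) ^ 2 * (q * (1 + ψ (-t)) * ((1 - ψ t * ψ (-t')) * (1 - ψ t * ψ t'))) = 0 := by
      linear_combination H2
    exact (mul_eq_zero.1 h).resolve_left hδ2
  have HqΦ : q * ((1 - ψ t * ψ (-t')) * (1 - ψ t * ψ t')) = 0 := by
    by_cases hb1 : 1 + ψ t' = 0
    · by_cases ha1 : 1 + ψ (-t) = 0
      · -- `ψ t = ψ t' = -1`: the factor `1 - ψ t ψ(-t')` vanishes
        have hb : ψ t' = -1 := by linear_combination hb1
        have ha' : ψ (-t) = -1 := by linear_combination ha1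
        have ha : ψ t = -1 := by
          have h := haa; rw [ha'] at h; linear_combination -h
        have hb' : ψ (-t') = -1 := by
          have h := hbb; rw [hb] at h; linear_combination -h
        rw [ha, hb, hb']; ring
      · have h := H2'
        rw [mul_assoc, mul_comm (1 + ψ (-t)), ← mul_assoc] at h
        exact (mul_eq_zero.1 h).resolve_right ha1
    · have h := H1'
      rw [mul_assoc, mul_comm (1 + ψ t'), ← mul_assoc] at h
      exact (mul_eq_zero.1 h).resolve_right hb1
  -- Step 4: the two uncovered points
  rw [eu, ev]
  linear_combination ((1 - ψ t * ψ (-t')) * (1 - ψ t * ψ t')) * S0 - (1 + ψ t) * HqΦ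
    + (1 + ψ t') * HyΦ


/-- **Shape (β-ii) forces two cosets of a cyclic subgroup.**  Let `Q, Y ⊆ A` (`|Y| = |Q| + 1`,
`|A| = 2|Q| + 4|Y|`), `t, t', d, c₀ ∈ A` satisfy: `Y` is `t`- and `t'`-free, `Q` is `t`- and `t'`-free; the
tilings (T2) `A = (Q+2d ⊔ Q+2d+t') ⊔ (Y ⊔ Y+t) ⊔ (Y+d ⊔ Y+d+t')` and
(T1) `A = (Q+2d ⊔ Q+2d−t) ⊔ (Y+c₀ ⊔ Y+c₀−t') ⊔ (Y+d ⊔ Y+d−t)` (as pairwise disjointness of the three pieces);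
(Per) `Y ⊔ (Y+t')` is `c₀`-periodic; (★) `Q ⊔ (Q+t) ⊆ Y ⊔ (Y+t')`.  Then `A` is the union of two cosets of a
cyclic subgroup (`⟨d⟩` if `t' = t`, `⟨d − t⟩` if `t' = −t`; no other case occurs). [folklore] -/
theorem two_cosets_of_shapeB {Q Y : Finset A} {t t' d c₀ : A}
    (hYt : Disjoint Y (Y.image (· + t))) (hYt' : Disjoint Y (Y.image (· + t')))
    (hQt : Disjoint Q (Q.image (· + t))) (hQt' : Disjoint Q (Q.image (· + t')))
    (hcard : Y.card = Q.card + 1) (hA : Fintype.card A = 2 * Q.card + 4 * Y.card)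
    (h12 : Disjoint (Q.image (· + (d + d)) ∪ Q.image (· + (d + d + t'))) (Y ∪ Y.image (· + t)))
    (h13 : Disjoint (Q.image (· + (d + d)) ∪ Q.image (· + (d + d + t')))
      (Y.image (· + d) ∪ Y.image (· + (d + t'))))
    (h23 : Disjoint (Y ∪ Y.image (· + t)) (Y.image (· + d) ∪ Y.image (· + (d + t'))))
    (k12 : Disjoint (Q.image (· + (d + d)) ∪ Q.image (· + (d + d - t)))
      (Y.image (· + c₀) ∪ Y.image (· + (c₀ - t'))))
    (k13 : Disjoint (Q.image (· + (d + d)) ∪ Q.image (· + (d + d - t)))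
      (Y.image (· + d) ∪ Y.image (· + (d - t))))
    (k23 : Disjoint (Y.image (· + c₀) ∪ Y.image (· + (c₀ - t'))) (Y.image (· + d) ∪ Y.image (· + (d - t))))
    (hper : (Y ∪ Y.image (· + t')).image (· + c₀) = Y ∪ Y.image (· + t'))
    (hsub : Q ∪ Q.image (· + t) ⊆ Y ∪ Y.image (· + t')) :
    ∃ g a b : A, ∀ x : A, x - a ∈ AddSubgroup.zmultiples g ∨ x - b ∈ AddSubgroup.zmultiples g := by
  obtain ⟨y₀, hy₀, y₁, hy₁, hE⟩ := star_uncovered hYt hYt' hQt hcard hsub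
  have key := shapeB_char_identity hYt hYt' hQt hQt' hA h12 h13 h23 k12 k13 k23 hper hsub hE hy₀ hy₁
  -- Step A: `t' = ± t`
  have htt : t' = t ∨ t' = -t := by
    by_contra hcon
    obtain ⟨ht1, ht2⟩ := not_or.1 hcon
    have hu : t - t' ≠ 0 := fun h => ht1 (sub_eq_zero.1 h).symm
    have hv : t + t' ≠ 0 := fun h => ht2 (eq_neg_of_add_eq_zero_right h)
    have hz : y₁ + t' ≠ y₀ := fun h => disjoint_left.1 hYt' hy₀ (mem_image.2 ⟨y₁, hy₁, h⟩)
    have hz' : y₀ ≠ y₁ + t' := fun h => hz h.symm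
    have hzt : y₁ + t' + (t - t') ≠ y₀ := by
      intro h
      have e : y₁ + t = y₀ := by rw [← h]; abel
      exact disjoint_left.1 hYt hy₀ (mem_image.2 ⟨y₁, hy₁, e⟩)
    have n1 : ¬ (y₀ + (t - t') = y₀) := fun h => hu (add_left_cancel (h.trans (add_zero y₀).symm))
    have n2 : ¬ (y₀ + (t + t') = y₀) := fun h => hv (add_left_cancel (h.trans (add_zero y₀).symm))
    have m1 : ¬ (y₁ + t' + (t - t') = y₁ + t') :=
      fun h => hu (add_left_cancel (h.trans (add_zero (y₁ + t')).symm))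
    have m2 : ¬ (y₁ + t' + (t + t') = y₁ + t') :=
      fun h => hv (add_left_cancel (h.trans (add_zero (y₁ + t')).symm))
    have I1 := two_point_inversion key y₀
    have I2 := two_point_inversion key (y₁ + t')
    rw [if_pos rfl, if_neg n1, if_neg n2, if_neg hz, if_neg hzt] at I1
    have hU2 : y₁ + t' + (t + t') = y₀ := by
      by_contra h; rw [if_neg h] at I1; split_ifs at I1 <;> omega
    have hU1 : ¬ (y₀ + (t - t') + (t + t') = y₀) := by
      intro h; rw [if_pos h, if_pos hU2] at I1; split_ifs at I1 <;> omega
    have h2t : (t - t') + (t + t') ≠ 0 := fun h => hU1 (by rw [add_assoc, h, add_zero])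
    have m3 : ¬ (y₁ + t' + (t - t') + (t + t') = y₁ + t') := by
      intro h
      rw [add_assoc] at h
      exact h2t (add_left_cancel (h.trans (add_zero (y₁ + t')).symm))
    have nV1 : ¬ (y₀ + (t - t') = y₁ + t') := by
      intro h
      rw [← hU2, add_assoc] at h
      have e : (t + t') + (t - t') = 0 := add_left_cancel (h.trans (add_zero (y₁ + t')).symm)
      exact h2t (by rwa [add_comm] at e)
    rw [if_neg hz', if_neg nV1, if_pos rfl, if_neg m1, if_neg m2, if_neg m3] at I2
    have hV2 : y₀ + (t + t') = y₁ + t' := by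
      by_contra h; rw [if_neg h] at I2; split_ifs at I2 <;> omega
    have h4 : (t + t') + (t + t') = 0 := by
      have h := hV2
      rw [← hU2, add_assoc] at h
      exact add_left_cancel (h.trans (add_zero (y₁ + t')).symm)
    have hy : y₁ = y₀ + t := by
      calc y₁ = y₁ + t' + (t + t') + t - ((t + t') + (t + t')) := by abel
        _ = y₀ + t - 0 := by rw [hU2, h4]
        _ = y₀ + t := sub_zero _
    exact disjoint_left.1 hYt hy₁ (mem_image.2 ⟨y₀, hy₀, hy.symm⟩)
  -- Step B: near-tiling endgame
  have cP : (Y ∪ Y.image (· + t)).card = Y.card + Y.card := card_pair_union hYt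
  have cC : (Q.image (· + (d + d)) ∪ Q.image (· + (d + d + t'))).card = Q.card + Q.card :=
    card_two_translates (disjoint_shift hQt' (d + d))
  rcases htt with h | h
  · -- `t' = t`, step `d`
    rw [eq_comm] at h
    subst h
    have hPe : (Y ∪ Y.image (· + t)).image (· + d) = Y.image (· + d) ∪ Y.image (· + (d + t)) := by
      rw [image_union, image_add_image, add_comm t d]
    have hC : Q.image (· + (d + d)) ∪ Q.image (· + (d + d + t)) ⊆
        (Y ∪ Y.image (· + t)).image (· + (d + d)) := by
      intro x hx
      rcases mem_union.1 hx with h | h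
      · obtain ⟨q, hq, rfl⟩ := mem_image.1 h
        exact mem_image.2 ⟨q, hsub (mem_union_left _ hq), rfl⟩
      · obtain ⟨q, hq, rfl⟩ := mem_image.1 h
        have hq' : q + t ∈ Y ∪ Y.image (· + t) := hsub (mem_union_right _ (mem_image.2 ⟨q, hq, rfl⟩))
        exact mem_image.2 ⟨q + t, hq', by abel⟩
    obtain ⟨a, b, hab⟩ := two_cosets_of_three_pieces (P := Y ∪ Y.image (· + t))
      (C := Q.image (· + (d + d)) ∪ Q.image (· + (d + d + t))) (e := d)
      h12.symm (by rw [hPe]; exact h23) (by rw [hPe]; exact h13.symm) (by rw [cP, cC]; omega)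
      (by rw [cP, cC]; omega) hC
    exact ⟨d, a, b, hab⟩
  · -- `t' = -t`, step `d - t`
    subst h
    have hPe : (Y ∪ Y.image (· + t)).image (· + (d + -t)) = Y.image (· + d) ∪ Y.image (· + (d + -t)) := by
      rw [image_union, image_add_image, show t + (d + -t) = d by abel, union_comm]
    have hC : Q.image (· + (d + d)) ∪ Q.image (· + (d + d + -t)) ⊆
        (Y ∪ Y.image (· + t)).image (· + (d + -t + (d + -t))) := by
      intro x hx
      rcases mem_union.1 hx with h | h
      · obtain ⟨q, hq, rfl⟩ := mem_image.1 h
        -- `q + t ∈ Y ⊔ (Y - t)`, so `q + 2t ∈ Y ⊔ (Y + t)`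
        have hq' : q + t ∈ Y ∪ Y.image (· + -t) := hsub (mem_union_right _ (mem_image.2 ⟨q, hq, rfl⟩))
        have hq'' : q + t + t ∈ Y ∪ Y.image (· + t) := by
          rcases mem_union.1 hq' with h1 | h1
          · exact mem_union_right _ (mem_image.2 ⟨q + t, h1, rfl⟩)
          · obtain ⟨p, hp, hpe⟩ := mem_image.1 h1
            refine mem_union_left _ ?_
            have : p = q + t + t := by rw [← hpe]; abel
            rwa [← this]
        exact mem_image.2 ⟨q + t + t, hq'', by abel⟩
      · obtain ⟨q, hq, rfl⟩ := mem_image.1 h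
        have hq' : q ∈ Y ∪ Y.image (· + -t) := hsub (mem_union_left _ hq)
        have hq'' : q + t ∈ Y ∪ Y.image (· + t) := by
          rcases mem_union.1 hq' with h1 | h1
          · exact mem_union_right _ (mem_image.2 ⟨q, h1, rfl⟩)
          · obtain ⟨p, hp, hpe⟩ := mem_image.1 h1
            refine mem_union_left _ ?_
            have : p = q + t := by rw [← hpe]; abel
            rwa [← this]
        exact mem_image.2 ⟨q + t, hq'', by abel⟩
    obtain ⟨a, b, hab⟩ := two_cosets_of_three_pieces (P := Y ∪ Y.image (· + t))
      (C := Q.image (· + (d + d)) ∪ Q.image (· + (d + d + -t))) (e := d + -t)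
      h12.symm (by rw [hPe]; exact h23) (by rw [hPe]; exact h13.symm) (by rw [cP, cC]; omega)
      (by rw [cP, cC]; omega) hC
    exact ⟨d + -t, a, b, hab⟩


end ShapeB

end Summit.MatrixMultiplication.OmegaCensus
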